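import Literature.NumberTheory.GaloisRepresentations.ResidualRepUnique
import HarnessLib

/-!
# Reductions and residual representations restrict along group homomorphisms

Topic `NumberTheory/GaloisRepresentations` (vocabulary of `ResidualGaloisRep.lean`:
`IsIntegralModelOf`, `integralReduction`, `IsReductionOf`, `HasResidualCharpolys`,
`IsSemisimplificationOf`, `IsResidualRepOf` relative to a valuation subring `O ⊆ F` and a residue
embedding `ι : O/𝔪 →+* k`; the framed Galois wrappers `FramedGaloisRep.IsReductionOf`,
`FramedGaloisRep.IsResidualRepOf` for `O = ℤ̄_ℓ ⊆ ℚ̄_ℓ`).  Theorem-only file (no definition, no named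
fact, D-0026).

For a homomorphism `φ : H →* G` (in the Galois case: the restriction `res : Γ_E → Γ_F` of an
extension `E/F`, `absGaloisRestrict F E`, so that `ρ ∘ res = ρ.restrictField E = ρ|_{Γ_E}`):

* `IsIntegralModelOf.comp`, `integralReduction_comp`, `IsReductionOf.comp`,
  `HasResidualCharpolys.comp` — integral models, reductions and residual characteristic polynomials
  of `ρ` give those of `ρ ∘ φ` by composition (same lattice, same frames);
* `IsSemisimplificationOf.comp` — `σ ∘ φ` is a semisimplification of `τ ∘ φ` as soon as it is
  semisimple (characteristic polynomials and the kernel condition compose);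
* `IsResidualRepOf.comp`, `IsResidualRepOf.comp_of_isIrreducible`,
  `IsResidualRepOf.comp_of_isAbsIrreducible` — **a residual representation `ρ̄` of `ρ` restricts to
  a residual representation `ρ̄ ∘ φ` of `ρ ∘ φ` whenever `ρ̄ ∘ φ` is semisimple**, in particular
  whenever it is (absolutely) irreducible.  (Semisimplicity of the restriction is NOT automatic —
  it holds e.g. for normal subgroups by Clifford — and without it `ρ̄ ∘ φ` need only have the same
  composition factors as a residual representation of `ρ ∘ φ`.)
* `FramedGaloisRep.isReductionOf_restrictField`, `FramedGaloisRep.isResidualRepOf_restrictField`,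
  `FramedGaloisRep.isResidualRepOf_restrictField_of_isAbsIrreducible` — the Galois case
  `ρ|_{Γ_E}`, `ρ̄ ∘ res`.

The occurrence served is the proof of ACC+ Thm. 6.1.1 (Allen–Calegari–Caraiani–Gee–Helm–Le Hung–
Newton–Scholze–Taylor–Thorne, Ann. of Math. 197 (2023), §6.5.12, arXiv:1812.09999 pp. 88–89), where
the hypotheses "`ρ̄` is a residual representation of `ρ`" and "`ρ̄ ≅ \overline{r_ι(π)}`" of the
theorem (`ACCGHLNSTT2023.automorphyLifting_crystalline_weightZero`, hypotheses (3) and (5): two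
`IsResidualRepOf` clauses for the same `τ`) are passed to a soluble extension `E/F` chosen so that
`ρ̄(G_E) = ρ̄(G_F)` — whence `ρ̄|_{G_E}` is still absolutely irreducible
(`ResidualHypothesesVSplit.lean`) and the present file applies.

## References

* [DarmonDiamondTaylor1995] H. Darmon, F. Diamond, R. Taylor, *Fermat's Last Theorem* (1995),
  §2.1, p. 54 (reductions, residual representations, Brauer–Nesbitt).
* [ACCGHLNSTT2023] P. B. Allen et al., *Potential automorphy over CM fields*, Ann. of Math. (2) 197
  (2023), §1 (Notation: `ρ̄`) and §6.5.12 (proof of Thm. 6.1.1, pp. 88–89).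
* [SerreAbelianLadic1968] J.-P. Serre, *Abelian ℓ-adic representations and elliptic curves* (1968),
  Ch. I §1.1, §2.1.
-/

noncomputable section

open scoped MatrixGroups
open IsLocalRing Field

namespace Literature.NumberTheory.GaloisRepresentations

/-! ### Semisimplifications -/

section GLHom

variable {G H : Type*} [Group G] [Group H] {k : Type*} [Field k] {n : ℕ}

/-- **Semisimplifications compose with homomorphisms, given semisimplicity**: if `σ` is a
semisimplification of `τ` and `σ ∘ φ` is semisimple, then `σ ∘ φ` is a semisimplification of
`τ ∘ φ` (equal characteristic polynomials and `ker (τ ∘ φ) ≤ ker (σ ∘ φ)` by composition).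
[cite: DarmonDiamondTaylor1995, §2.1, p. 54] -/
theorem IsSemisimplificationOf.comp {σ τ : G →* GL (Fin n) k} (h : IsSemisimplificationOf σ τ)
    (φ : H →* G) (hss : (glRepresentation (σ.comp φ)).IsSemisimpleRepresentation) :
    IsSemisimplificationOf (σ.comp φ) (τ.comp φ) := by
  refine ⟨hss, fun x => h.2.1 (φ x), fun x hx => ?_⟩
  rw [MonoidHom.mem_ker, MonoidHom.comp_apply] at hx ⊢
  exact h.2.2 hx

/-- An irreducible `GL_n(k)`-valued homomorphism is semisimple (the lattice of subrepresentations
is simple, hence complemented). [folklore] -/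
theorem isSemisimpleRepresentation_of_isIrreducible {σ : G →* GL (Fin n) k}
    (h : (glRepresentation σ).IsIrreducible) : (glRepresentation σ).IsSemisimpleRepresentation := by
  haveI : IsSimpleOrder (Subrepresentation (glRepresentation σ)) := h
  exact (inferInstance : ComplementedLattice (Subrepresentation (glRepresentation σ)))

end GLHom

/-! ### Integral models, reductions, residual representations -/

section Reduction

variable {F : Type*} [Field F] {O : ValuationSubring F} {n : ℕ}
variable {G H : Type*} [Group G] [Group H] {k : Type*} [Field k]

/-- An integral model of `ρ` composed with `φ` is an integral model of `ρ ∘ φ` (same frame `P`).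
[cite: SerreAbelianLadic1968, Ch. I §1.1] -/
theorem IsIntegralModelOf.comp {ρ : G →* GL (Fin n) F} {ρ₀ : G →* GL (Fin n) O}
    (h : IsIntegralModelOf ρ ρ₀) (φ : H →* G) : IsIntegralModelOf (ρ.comp φ) (ρ₀.comp φ) := by
  obtain ⟨P, hP⟩ := h
  exact ⟨P, fun x => hP (φ x)⟩

/-- Reduction commutes with composition. [folklore] -/
theorem integralReduction_comp (ι : ResidueField O →+* k) (ρ₀ : G →* GL (Fin n) O) (φ : H →* G) :
    integralReduction ι (ρ₀.comp φ) = (integralReduction ι ρ₀).comp φ :=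
  rfl

/-- **A reduction of `ρ` composed with `φ` is a reduction of `ρ ∘ φ`** (same lattice, same
frames). [cite: DarmonDiamondTaylor1995, §2.1, p. 54] -/
theorem IsReductionOf.comp {ι : ResidueField O →+* k} {ρ : G →* GL (Fin n) F}
    {τ : G →* GL (Fin n) k} (h : IsReductionOf ι ρ τ) (φ : H →* G) :
    IsReductionOf ι (ρ.comp φ) (τ.comp φ) := by
  obtain ⟨ρ₀, Q, hmodel, hQ⟩ := h
  exact ⟨ρ₀.comp φ, Q, hmodel.comp φ, fun x => hQ (φ x)⟩

/-- Residual characteristic polynomials compose with `φ`. [folklore] -/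
theorem HasResidualCharpolys.comp {ι : ResidueField O →+* k} {ρ : G →* GL (Fin n) F}
    {τ : G →* GL (Fin n) k} (h : HasResidualCharpolys ι ρ τ) (φ : H →* G) :
    HasResidualCharpolys ι (ρ.comp φ) (τ.comp φ) :=
  fun x => h (φ x)

/-- **A residual representation `ρ̄` of `ρ` restricts to a residual representation `ρ̄ ∘ φ` of
`ρ ∘ φ` whenever `ρ̄ ∘ φ` is semisimple**: `ρ̄` is a semisimplification of a reduction `τ₀` of `ρ`,
`τ₀ ∘ φ` is a reduction of `ρ ∘ φ` (`IsReductionOf.comp`) and `ρ̄ ∘ φ` is a semisimplification of it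
(`IsSemisimplificationOf.comp`). [cite: DarmonDiamondTaylor1995, §2.1, p. 54]
[cite: ACCGHLNSTT2023, §1 (Notation)] -/
theorem IsResidualRepOf.comp {ι : ResidueField O →+* k} {ρ : G →* GL (Fin n) F}
    {τ : G →* GL (Fin n) k} (h : IsResidualRepOf ι ρ τ) (φ : H →* G)
    (hss : (glRepresentation (τ.comp φ)).IsSemisimpleRepresentation) :
    IsResidualRepOf ι (ρ.comp φ) (τ.comp φ) := by
  obtain ⟨τ₀, hred, hsemi⟩ := h
  exact ⟨τ₀.comp φ, hred.comp φ, hsemi.comp φ hss⟩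

/-- **A residual representation whose restriction is irreducible restricts to a residual
representation.** [cite: DarmonDiamondTaylor1995, §2.1, p. 54] -/
theorem IsResidualRepOf.comp_of_isIrreducible {ι : ResidueField O →+* k} {ρ : G →* GL (Fin n) F}
    {τ : G →* GL (Fin n) k} (h : IsResidualRepOf ι ρ τ) (φ : H →* G)
    (hirr : (glRepresentation (τ.comp φ)).IsIrreducible) :
    IsResidualRepOf ι (ρ.comp φ) (τ.comp φ) :=
  h.comp φ (isSemisimpleRepresentation_of_isIrreducible hirr)

/-- **A residual representation whose restriction is absolutely irreducible restricts to a
residual representation.** [cite: DarmonDiamondTaylor1995, §2.1, p. 54] -/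
theorem IsResidualRepOf.comp_of_isAbsIrreducible {ι : ResidueField O →+* k}
    {ρ : G →* GL (Fin n) F} {τ : G →* GL (Fin n) k} (h : IsResidualRepOf ι ρ τ) (φ : H →* G)
    (habs : IsAbsIrreducible (τ.comp φ)) : IsResidualRepOf ι (ρ.comp φ) (τ.comp φ) :=
  h.comp_of_isIrreducible φ habs.isIrreducible_glRepresentation

end Reduction

/-! ### The Galois case: `ρ|_{Γ_E}` and `ρ̄ ∘ res` -/

section Galois

variable {K : Type} [Field K] {ℓ : ℕ} [Fact ℓ.Prime] {n : ℕ} {k : Type*} [Field k]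

/-- **A reduction of `ρ : Γ_K → GL_n(ℚ̄_ℓ)` restricts to a reduction of `ρ|_{Γ_E}`**:
`ρ̄ ∘ res` is a reduction of `ρ.restrictField E = ρ ∘ res`, `res = absGaloisRestrict K E`.
[cite: DarmonDiamondTaylor1995, §2.1, p. 54] [cite: SerreAbelianLadic1968, Ch. I §2.1] -/
theorem FramedGaloisRep.isReductionOf_restrictField {ρ : FramedGaloisRep K (PadicAlgCl ℓ) n}
    {ι : padicAlgClResidueField ℓ →+* k} {τ : absoluteGaloisGroup K →* GL (Fin n) k}
    (h : ρ.IsReductionOf ι τ) (E : Type*) [Field E] [Algebra K E] :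
    (ρ.restrictField E).IsReductionOf ι (τ.comp (absGaloisRestrict K E).toMonoidHom) :=
  GaloisRepresentations.IsReductionOf.comp h _

/-- **A residual representation of `ρ : Γ_K → GL_n(ℚ̄_ℓ)` restricts to a residual representation of
`ρ|_{Γ_E}` whenever `ρ̄ ∘ res` is semisimple.** [cite: ACCGHLNSTT2023, §1 (Notation) and §6.5.12]
[cite: DarmonDiamondTaylor1995, §2.1, p. 54] -/
theorem FramedGaloisRep.isResidualRepOf_restrictField {ρ : FramedGaloisRep K (PadicAlgCl ℓ) n}
    {ι : padicAlgClResidueField ℓ →+* k} {τ : absoluteGaloisGroup K →* GL (Fin n) k}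
    (h : ρ.IsResidualRepOf ι τ) (E : Type*) [Field E] [Algebra K E]
    (hss : (glRepresentation (τ.comp (absGaloisRestrict K E).toMonoidHom)).IsSemisimpleRepresentation) :
    (ρ.restrictField E).IsResidualRepOf ι (τ.comp (absGaloisRestrict K E).toMonoidHom) :=
  GaloisRepresentations.IsResidualRepOf.comp h _ hss

/-- **A residual representation of `ρ : Γ_K → GL_n(ℚ̄_ℓ)` restricts to a residual representation of
`ρ|_{Γ_E}` whenever `ρ̄ ∘ res` is absolutely irreducible** — the form in which hypotheses (3) and (5)
of `ACCGHLNSTT2023.automorphyLifting_crystalline_weightZero` (`ρ.IsResidualRepOf (RingHom.id _) τ`,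
`r.IsResidualRepOf (RingHom.id _) τ`) pass to an extension `E/F` with `ρ̄(G_E) = ρ̄(G_F)` in the
proof of ACC+ Thm. 6.1.1 (absolute irreducibility of `τ ∘ res`: `ResidualHypothesesVSplit.lean`).
[cite: ACCGHLNSTT2023, §6.5.12 (proof of Thm. 6.1.1, pp. 88–89)]
[cite: DarmonDiamondTaylor1995, §2.1, p. 54] -/
theorem FramedGaloisRep.isResidualRepOf_restrictField_of_isAbsIrreducible
    {ρ : FramedGaloisRep K (PadicAlgCl ℓ) n} {ι : padicAlgClResidueField ℓ →+* k}
    {τ : absoluteGaloisGroup K →* GL (Fin n) k} (h : ρ.IsResidualRepOf ι τ) (E : Type*) [Field E]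
    [Algebra K E] (habs : IsAbsIrreducible (τ.comp (absGaloisRestrict K E).toMonoidHom)) :
    (ρ.restrictField E).IsResidualRepOf ι (τ.comp (absGaloisRestrict K E).toMonoidHom) :=
  GaloisRepresentations.IsResidualRepOf.comp_of_isAbsIrreducible h _ habs

end Galois

end Literature.NumberTheory.GaloisRepresentations

end
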